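import Literature.Barriers.BirchSwinnertonDyer.RankNotSumOfLocalInvariantsK1Arithmetic
import Literature.NumberTheory.EllipticCurves.TwoDescent
import Mathlib.RingTheory.DedekindDomain.AdicValuation
import Mathlib.RingTheory.DedekindDomain.PID
import Mathlib.RingTheory.UniqueFactorizationDomain.Multiplicity
import HarnessLib

/-!
# `rk E(F₄)` for `E = 480a1` via `ℚ(√-1)`, II: `K1(S, 2)` and square-class characters

Second groundwork file for the complete `2`-descents over `K1 = ℚ(√-1)` (see
`RankNotSumOfLocalInvariantsK1Arithmetic.lean`). With `S` the set of primes of `ℤ[i]` dividing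
`D = 2·3·5·41·73` we prove the explicit description of the group `K1(S, 2)` of Silverman,
*The Arithmetic of Elliptic Curves*, Ch. X §1 (elements of `K1ˣ/K1ˣ²` with even valuation
outside `S`), for the class-number-one ring `ℤ[i]`:

* `exists_sq_decomposition_int`: a non-zero Gaussian integer whose multiplicity at every prime not
  dividing `D` is even is `i^a · ∏_j g_j^{e_j} · t²` with `a, e_j ∈ {0, 1}`, the `g_j` being the
  eight primes `1+i, 3, 2±i, 5±4i, 8±3i` (`gen : Fin 8 → ℤ[i]`) — unique factorisation in the
  Euclidean domain `ℤ[i]` and its unit group `{±1, ±i}`;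
* `K1.exists_sq_decomposition`: the same for `x ∈ K1ˣ` whose `𝔭`-adic valuation
  (Mathlib's `IsDedekindDomain.HeightOneSpectrum.valuation` of the prime `𝔭 = (p)`,
  `primeSpec p`) is even for every prime `p ∤ D`; so `K1(S, 2)` is spanned by the classes of
  `i` and the `g_j` (`2⁹` elements).

and set up the **square-class characters** through which the descents are read: a
`ℤ/2`-valued function on `ℤ[i] ∖ {0}` turning products into sums (`MulBit`) extends to `K1ˣ`
(`MulBit.onK1`, independent of the fraction chosen, `MulBit.onK1_div`), kills squares, and
induces a homomorphism `K1ˣ/K1ˣ² → ℤ/2` (`MulBit.hom`, `MulBit.hom_sqClass`, on the tree's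
`SqUnits K1`); its value on `i^a ∏ g_j^{e_j} t²` is the `𝔽₂`-linear form `a χ(i) + Σ e_j χ(g_j)`
(`MulBit.onK1_decomposition`). First instance: the parity of the multiplicity at a prime `p`
(`MulBit.ofPrime`), which on `K1` is the parity of the `𝔭`-adic valuation
(`MulBit.ofPrime_onK1_eq_zero_iff`).

## References

* J. H. Silverman, *The Arithmetic of Elliptic Curves*, 2nd ed., GTM 106 (2009), Ch. X §1,
  Prop. X.1.4 and the group `K(S, 2)` (proof of Thm. X.1.1). [SilvermanAEC2009]
* T. Dokchitser, V. Dokchitser, *A note on the Mordell–Weil rank modulo `n`*, J. Number Theory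
  131 (2011) 1833–1839, arXiv:0910.4588, proof of Thm. 2. [DokchitserDokchitser2011RankModN]
-/

namespace Literature.Barriers.BirchSwinnertonDyer.DokchitserDokchitser2011

open QuadraticAlgebra IsDedekindDomain WeierstrassCurve.Affine

/-- Mathlib's Gaussian integers `ℤ√-1` (the notation `ℤ[i]` is local to Mathlib's file). -/
local notation "ℤ[i]" => GaussianInt

/-! ### Multiplicity at a prime of `ℤ[i]` and the unit part -/

section Multiplicity

variable {p : ℤ[i]}

/-- The multiplicity of a prime in a non-zero Gaussian integer is finite. [folklore] -/
theorem finiteMultiplicity_of_prime (hp : Prime p) {z : ℤ[i]} (hz : z ≠ 0) :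
    FiniteMultiplicity p z :=
  FiniteMultiplicity.of_prime_left hp hz

/-- `emultiplicity p (p^m c) = m` when `p ∤ c`. [folklore] -/
theorem emultiplicity_pow_mul_of_not_dvd (hp : Prime p) {c : ℤ[i]} (hc : ¬ p ∣ c) (m : ℕ) :
    emultiplicity p (p ^ m * c) = m := by
  rw [emultiplicity_mul hp, emultiplicity_pow_self_of_prime hp, emultiplicity_eq_zero.mpr hc,
    add_zero]

/-- `multiplicity p (p^m c) = m` when `p ∤ c`. [folklore] -/
theorem multiplicity_pow_mul_of_not_dvd (hp : Prime p) {c : ℤ[i]} (hc : ¬ p ∣ c) (m : ℕ) :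
    multiplicity p (p ^ m * c) = m :=
  multiplicity_eq_of_emultiplicity_eq_some (emultiplicity_pow_mul_of_not_dvd hp hc m)

/-- **Uniqueness of the decomposition `z = p^m c`, `p ∤ c`.** [folklore] -/
theorem eq_of_pow_mul_eq_pow_mul (hp : Prime p) {m n : ℕ} {c d : ℤ[i]} (hc : ¬ p ∣ c)
    (hd : ¬ p ∣ d) (h : p ^ m * c = p ^ n * d) : m = n ∧ c = d := by
  have hmn : m = n := by
    have h1 := multiplicity_pow_mul_of_not_dvd hp hc m
    rw [h, multiplicity_pow_mul_of_not_dvd hp hd n] at h1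
    exact h1.symm
  subst hmn
  exact ⟨rfl, mul_left_cancel₀ (pow_ne_zero m hp.ne_zero) h⟩

/-- **Existence of the decomposition**: a non-zero `z` is `p^m c` with `p ∤ c` and
`m = multiplicity p z`. [folklore] -/
theorem exists_eq_pow_multiplicity_mul (hp : Prime p) {z : ℤ[i]} (hz : z ≠ 0) :
    ∃ c : ℤ[i], z = p ^ multiplicity p z * c ∧ ¬ p ∣ c :=
  (finiteMultiplicity_of_prime hp hz).exists_eq_pow_mul_and_not_dvd

/-- The multiplicity of a decomposition `z = p^m c`, `p ∤ c`, is `m`. [folklore] -/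
theorem multiplicity_eq_of_eq_pow_mul (hp : Prime p) {z c : ℤ[i]} {m : ℕ} (hc : ¬ p ∣ c)
    (h : z = p ^ m * c) : multiplicity p z = m := by
  rw [h]; exact multiplicity_pow_mul_of_not_dvd hp hc m

/-- **The multiplicity is additive** on non-zero Gaussian integers. [folklore] -/
theorem multiplicity_mul_eq (hp : Prime p) {z w : ℤ[i]} (hz : z ≠ 0) (hw : w ≠ 0) :
    multiplicity p (z * w) = multiplicity p z + multiplicity p w :=
  multiplicity_mul hp (finiteMultiplicity_of_prime hp (mul_ne_zero hz hw))

/-- The multiplicity of `p` in an element it does not divide is `0`. [folklore] -/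
theorem multiplicity_eq_zero_of_not_dvd {c : ℤ[i]} (hc : ¬ p ∣ c) : multiplicity p c = 0 :=
  multiplicity_eq_zero.mpr hc

/-- The multiplicity of a prime `p` in `p ^ m` is `m`. [folklore] -/
theorem multiplicity_pow_self' (hp : Prime p) (m : ℕ) : multiplicity p (p ^ m) = m :=
  multiplicity_pow_self_of_prime hp m

end Multiplicity

/-! ### The eight primes as a family, and `K1(S,2)` on `ℤ[i]` -/

/-- The eight primes `1+i, 3, 2+i, 2-i, 5+4i, 5-4i, 8+3i, 8-3i` of `ℤ[i]` dividing
`D = 2·3·5·41·73`, as a family. [folklore] -/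
def gen : Fin 8 → ℤ[i] := ![g2, 3, g5a, g5b, g41a, g41b, g73a, g73b]

/-- Values of `gen`. [folklore] -/
theorem gen_apply : gen 0 = g2 ∧ gen 1 = 3 ∧ gen 2 = g5a ∧ gen 3 = g5b ∧ gen 4 = g41a ∧
    gen 5 = g41b ∧ gen 6 = g73a ∧ gen 7 = g73b :=
  ⟨rfl, rfl, rfl, rfl, rfl, rfl, rfl, rfl⟩

/-- Every `gen j` is prime. [folklore] -/
theorem prime_gen (j : Fin 8) : Prime (gen j) := by
  fin_cases j
  exacts [prime_g2, prime_three, prime_g5a, prime_g5b, prime_g41a, prime_g41b, prime_g73a,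
    prime_g73b]

/-- Every `gen j` is non-zero. [folklore] -/
theorem gen_ne_zero (j : Fin 8) : gen j ≠ 0 := (prime_gen j).ne_zero

/-- Every `gen j` divides `D` (explicit cofactors). [folklore] -/
theorem gen_dvd_D (j : Fin 8) : gen j ∣ D := by
  fin_cases j
  exacts [Dvd.intro ⟨44895, -44895⟩ (by decide), Dvd.intro 29930 (by decide),
    Dvd.intro ⟨35916, -17958⟩ (by decide), Dvd.intro ⟨35916, 17958⟩ (by decide),
    Dvd.intro ⟨10950, -8760⟩ (by decide), Dvd.intro ⟨10950, 8760⟩ (by decide),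
    Dvd.intro ⟨9840, -3690⟩ (by decide), Dvd.intro ⟨9840, 3690⟩ (by decide)]

/-- A prime dividing `D` is associated to some `gen j`. [folklore] -/
theorem exists_associated_gen_of_dvd_D {p : ℤ[i]} (hp : Prime p) (h : p ∣ D) :
    ∃ j : Fin 8, Associated p (gen j) := by
  rcases associated_of_prime_of_dvd_D hp h with h | h | h | h | h | h | h | h
  exacts [⟨0, h⟩, ⟨1, h⟩, ⟨2, h⟩, ⟨3, h⟩, ⟨4, h⟩, ⟨5, h⟩, ⟨6, h⟩, ⟨7, h⟩]

/-- A prime not dividing `D` does not divide any `gen j`. [folklore] -/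
theorem not_dvd_gen_of_not_dvd_D {p : ℤ[i]} (h : ¬ p ∣ D) (j : Fin 8) : ¬ p ∣ gen j :=
  fun hj => h (hj.trans (gen_dvd_D j))

/-- The norm of every `gen j` is at least `2` in absolute value. [folklore] -/
theorem two_le_natAbs_norm_gen (j : Fin 8) : 2 ≤ (Zsqrtd.norm (gen j)).natAbs := by
  fin_cases j <;> decide

/-- The product `∏_j (gen j)^(e j)`. [folklore] -/
def genProd (e : Fin 8 → ℕ) : ℤ[i] := ∏ j, gen j ^ e j

/-- `genProd e ≠ 0`. [folklore] -/
theorem genProd_ne_zero (e : Fin 8 → ℕ) : genProd e ≠ 0 :=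
  Finset.prod_ne_zero_iff.mpr fun j _ => pow_ne_zero _ (gen_ne_zero j)

/-- `genProd 0 = 1`. [folklore] -/
theorem genProd_zero : genProd 0 = 1 := by simp [genProd]

/-- Incrementing one exponent multiplies by that generator. [folklore] -/
theorem genProd_update_succ (e : Fin 8 → ℕ) (j : Fin 8) :
    genProd (Function.update e j (e j + 1)) = gen j * genProd e := by
  unfold genProd
  rw [← Finset.mul_prod_erase Finset.univ _ (Finset.mem_univ j),
    ← Finset.mul_prod_erase Finset.univ (fun k => gen k ^ e k) (Finset.mem_univ j),
    Function.update_self, pow_succ', mul_assoc]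
  congr 1
  refine congrArg _ (Finset.prod_congr rfl fun k hk => ?_)
  rw [Function.update_of_ne (Finset.ne_of_mem_erase hk)]

/-- Setting an exponent `2` to `0` divides off the square of that generator. [folklore] -/
theorem genProd_update_two (e : Fin 8 → ℕ) (j : Fin 8) (hj : e j = 2) :
    genProd e = gen j ^ 2 * genProd (Function.update e j 0) := by
  unfold genProd
  rw [← Finset.mul_prod_erase Finset.univ _ (Finset.mem_univ j),
    ← Finset.mul_prod_erase Finset.univ (fun k => gen k ^ Function.update e j 0 k)
      (Finset.mem_univ j), Function.update_self, pow_zero, one_mul, hj]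
  refine congrArg _ (Finset.prod_congr rfl fun k hk => ?_)
  rw [Function.update_of_ne (Finset.ne_of_mem_erase hk)]

/-- The multiplicity of a prime `p ∤ D` in `genProd e` is `0`. [folklore] -/
theorem not_dvd_genProd {p : ℤ[i]} (hp : Prime p) (h : ¬ p ∣ D) (e : Fin 8 → ℕ) :
    ¬ p ∣ genProd e := by
  intro hd
  obtain ⟨j, -, hj⟩ := (Prime.dvd_finsetProd_iff hp _).mp hd
  exact not_dvd_gen_of_not_dvd_D h j (hp.dvd_of_dvd_pow hj)

/-- **`K1(S, 2)` on `ℤ[i]` (Silverman AEC X.1, the group `K(S,2)`, made explicit for the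
principal ideal domain `ℤ[i]` with unit group `{±1, ±i}`)**: a non-zero Gaussian integer all of
whose multiplicities at primes not dividing `D = 2·3·5·41·73` are even is
`i^a · ∏_j (gen j)^(e j) · t²` with `a, e j ∈ {0, 1}` and `t ≠ 0`. Proof by induction on the
norm: peel off a prime factor `q`; if `q ∣ D` it is a unit multiple of some `gen j`, otherwise
`q² ∣ Z`. [cite: SilvermanAEC2009, Ch. X §1 (K(S,2))] -/
theorem exists_sq_decomposition_int {Z : ℤ[i]} (hZ : Z ≠ 0)
    (h : ∀ p : ℤ[i], Prime p → ¬ p ∣ D → Even (multiplicity p Z)) :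
    ∃ (a : ℕ) (e : Fin 8 → ℕ) (t : ℤ[i]), t ≠ 0 ∧ a < 2 ∧ (∀ j, e j < 2) ∧
      Z = gI ^ a * genProd e * t ^ 2 := by
  -- strong induction on the norm
  suffices H : ∀ (n : ℕ) (Z : ℤ[i]), (Zsqrtd.norm Z).natAbs = n → Z ≠ 0 →
      (∀ p : ℤ[i], Prime p → ¬ p ∣ D → Even (multiplicity p Z)) →
      ∃ (a : ℕ) (e : Fin 8 → ℕ) (t : ℤ[i]), t ≠ 0 ∧ a < 2 ∧ (∀ j, e j < 2) ∧
        Z = gI ^ a * genProd e * t ^ 2 from H _ Z rfl hZ h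
  intro n
  induction n using Nat.strong_induction_on with
  | _ n ih =>
  intro Z hn hZ h
  by_cases hu : IsUnit Z
  · obtain ⟨a, w, ha, hw, hZw⟩ := exists_eq_gI_pow_mul_sq_of_isUnit hu
    exact ⟨a, 0, w, hw.ne_zero, ha, fun j => by simp, by rw [genProd_zero, mul_one]; exact hZw⟩
  obtain ⟨q, hqirr, hqZ⟩ := WfDvdMonoid.exists_irreducible_factor hu hZ
  have hq : Prime q := hqirr.prime
  -- norms
  have hnormlt : ∀ {Y c : ℤ[i]}, Z = c * Y → 2 ≤ (Zsqrtd.norm c).natAbs →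
      (Zsqrtd.norm Y).natAbs < n := by
    intro Y c hY hc
    have hY0 : Y ≠ 0 := by rintro rfl; exact hZ (by rw [hY, mul_zero])
    have hpos : 0 < (Zsqrtd.norm Y).natAbs :=
      Int.natAbs_pos.mpr (mt GaussianInt.norm_eq_zero.mp hY0)
    have : (Zsqrtd.norm Z).natAbs = (Zsqrtd.norm c).natAbs * (Zsqrtd.norm Y).natAbs := by
      rw [hY, Zsqrtd.norm_mul, Int.natAbs_mul]
    rw [← hn, this]
    nlinarith
  by_cases hqD : q ∣ D
  · -- `q` is associated to some `gen j`, so `gen j ∣ Z`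
    obtain ⟨j, hj⟩ := exists_associated_gen_of_dvd_D hq hqD
    obtain ⟨Y, hY⟩ : gen j ∣ Z := hj.dvd_iff_dvd_left.mp hqZ
    have hY0 : Y ≠ 0 := by rintro rfl; exact hZ (by rw [hY, mul_zero])
    have hlt : (Zsqrtd.norm Y).natAbs < n := hnormlt hY (two_le_natAbs_norm_gen j)
    have hY' : ∀ p : ℤ[i], Prime p → ¬ p ∣ D → Even (multiplicity p Y) := by
      intro p hp hpD
      have := h p hp hpD
      rwa [hY, multiplicity_mul_eq hp (gen_ne_zero j) hY0,
        multiplicity_eq_zero_of_not_dvd (not_dvd_gen_of_not_dvd_D hpD j), zero_add] at this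
    obtain ⟨a, e, t, ht, ha, he, hYe⟩ := ih _ hlt Y rfl hY0 hY'
    -- increment the exponent of `gen j`
    by_cases hej : e j = 0
    · refine ⟨a, Function.update e j 1, t, ht, ha, fun k => ?_, ?_⟩
      · rcases eq_or_ne k j with rfl | hk
        · rw [Function.update_self]; norm_num
        · rw [Function.update_of_ne hk]; exact he k
      · have : Function.update e j 1 = Function.update e j (e j + 1) := by rw [hej]
        rw [this, genProd_update_succ, hY, hYe]; ring
    · have hej1 : e j = 1 := by have := he j; omega
      refine ⟨a, Function.update e j 0, gen j * t, mul_ne_zero (gen_ne_zero j) ht, ha,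
        fun k => ?_, ?_⟩
      · rcases eq_or_ne k j with rfl | hk
        · rw [Function.update_self]; norm_num
        · rw [Function.update_of_ne hk]; exact he k
      · have h2 : Function.update e j (e j + 1) j = 2 := by rw [Function.update_self, hej1]
        have key := genProd_update_two (Function.update e j (e j + 1)) j h2
        rw [Function.update_idem, genProd_update_succ] at key
        rw [hY, hYe, mul_pow]
        linear_combination gI ^ a * t ^ 2 * key
  · -- `q ∤ D`: the multiplicity is even and positive, so `q² ∣ Z`
    have heven := h q hq hqD
    have hpos : 0 < multiplicity q Z :=
      (finiteMultiplicity_of_prime hq hZ).lt_multiplicity_of_lt_emultiplicity (by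
        rw [Nat.cast_zero]; exact emultiplicity_pos_of_dvd hqZ)
    have h2 : 2 ≤ multiplicity q Z := by obtain ⟨k, hk⟩ := heven; omega
    obtain ⟨Y, hY⟩ : q ^ 2 ∣ Z := pow_dvd_of_le_multiplicity h2
    have hY0 : Y ≠ 0 := by rintro rfl; exact hZ (by rw [hY, mul_zero])
    have hq2 : 2 ≤ (Zsqrtd.norm (q ^ 2)).natAbs := by
      have h1 : (Zsqrtd.norm q).natAbs ≠ 1 := fun h1 => hq.not_unit (Zsqrtd.norm_eq_one_iff.mp h1)
      have h0 : (Zsqrtd.norm q).natAbs ≠ 0 := fun h0 =>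
        hq.ne_zero (GaussianInt.norm_eq_zero.mp (Int.natAbs_eq_zero.mp h0))
      have hk : 2 ≤ (Zsqrtd.norm q).natAbs := by omega
      rw [pow_two, Zsqrtd.norm_mul, Int.natAbs_mul]
      nlinarith
    have hlt : (Zsqrtd.norm Y).natAbs < n := hnormlt hY hq2
    have hY' : ∀ p : ℤ[i], Prime p → ¬ p ∣ D → Even (multiplicity p Y) := by
      intro p hp hpD
      have := h p hp hpD
      rw [hY, multiplicity_mul_eq hp (pow_ne_zero 2 hq.ne_zero) hY0] at this
      by_cases hpq : p ∣ q
      · have hpq' : Associated p q := hp.associated_of_dvd hq hpq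
        rw [← multiplicity_eq_of_associated_left hpq', multiplicity_pow_self' hq] at this
        exact (Nat.even_add.mp this).mp (by norm_num)
      · rw [multiplicity_eq_zero_of_not_dvd (fun h' => hpq (hp.dvd_of_dvd_pow h')),
          zero_add] at this
        exact this
    obtain ⟨a, e, t, ht, ha, he, hYe⟩ := ih _ hlt Y rfl hY0 hY'
    exact ⟨a, e, q * t, mul_ne_zero hq.ne_zero ht, ha, he, by rw [hY, hYe]; ring⟩

/-! ### The `𝔭`-adic valuations of `K1` and `K1(S,2)` -/

/-- The height-one prime `(p)` of `ℤ[i]` generated by a prime element `p`. [folklore] -/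
def primeSpec (p : ℤ[i]) (hp : Prime p) : HeightOneSpectrum ℤ[i] :=
  ⟨Ideal.span {p}, (Ideal.span_singleton_prime hp.ne_zero).mpr hp, by
    rw [Ne, Ideal.span_singleton_eq_bot]; exact hp.ne_zero⟩

/-- Every height-one prime of the PID `ℤ[i]` is `(p)` for a prime element `p`. [folklore] -/
theorem exists_eq_primeSpec (v : HeightOneSpectrum ℤ[i]) :
    ∃ (p : ℤ[i]) (hp : Prime p), v = primeSpec p hp := by
  obtain ⟨p, hp⟩ := (IsPrincipalIdealRing.principal v.asIdeal).principal
  have hp' : v.asIdeal = Ideal.span {p} := hp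
  have hp0 : p ≠ 0 := by
    intro h; rw [h] at hp'
    exact v.ne_bot (by rw [hp', Ideal.span_singleton_eq_bot])
  have hprime : Prime p := (Ideal.span_singleton_prime hp0).mp (hp' ▸ v.isPrime)
  exact ⟨p, hprime, HeightOneSpectrum.ext hp'⟩

/-- **The `𝔭`-adic valuation of a Gaussian integer** is `exp (-(multiplicity p z))`.
[folklore] -/
theorem intValuation_primeSpec {p : ℤ[i]} (hp : Prime p) {z : ℤ[i]} (hz : z ≠ 0) :
    (primeSpec p hp).intValuation z = WithZero.exp (-(multiplicity p z : ℤ)) := by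
  rw [HeightOneSpectrum.intValuation_eq_exp_neg_multiplicity _ hz]
  congr 3
  refine multiplicity_eq_of_emultiplicity_eq ((emultiplicity_eq_emultiplicity_iff).mpr fun n => ?_)
  change (Ideal.span {p}) ^ n ∣ Ideal.span {z} ↔ p ^ n ∣ z
  rw [Ideal.span_singleton_pow, Ideal.span_singleton_dvd_span_singleton_iff_dvd]

/-- The `𝔭`-adic valuation of `toK1 z`, `z ≠ 0`. [folklore] -/
theorem valuation_toK1 {p : ℤ[i]} (hp : Prime p) {z : ℤ[i]} (hz : z ≠ 0) :
    (primeSpec p hp).valuation K1 (toK1 z) = WithZero.exp (-(multiplicity p z : ℤ)) := by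
  rw [← algebraMap_gaussianInt_K1, HeightOneSpectrum.valuation_of_algebraMap,
    intValuation_primeSpec hp hz]

/-- **The `𝔭`-adic valuation of a fraction**: `log v_𝔭(toK1 z / toK1 w) = mult_p w - mult_p z`.
[folklore] -/
theorem log_valuation_toK1_div {p : ℤ[i]} (hp : Prime p) {z w : ℤ[i]} (hz : z ≠ 0)
    (hw : w ≠ 0) :
    WithZero.log ((primeSpec p hp).valuation K1 (toK1 z / toK1 w)) =
      (multiplicity p w : ℤ) - multiplicity p z := by
  rw [map_div₀, valuation_toK1 hp hz, valuation_toK1 hp hw, ← WithZero.exp_sub, WithZero.log_exp]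
  ring

/-- Elements of `ℤ[i]` are `𝔭`-integral. [folklore] -/
theorem valuation_toK1_le_one {p : ℤ[i]} (hp : Prime p) (z : ℤ[i]) :
    (primeSpec p hp).valuation K1 (toK1 z) ≤ 1 := by
  rw [← algebraMap_gaussianInt_K1]
  exact HeightOneSpectrum.valuation_le_one _ z

/-- **`p ∤ z` iff `toK1 z` is a `𝔭`-adic unit.** [folklore] -/
theorem valuation_toK1_eq_one_iff {p : ℤ[i]} (hp : Prime p) {z : ℤ[i]} :
    (primeSpec p hp).valuation K1 (toK1 z) = 1 ↔ ¬ p ∣ z := by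
  rw [← algebraMap_gaussianInt_K1, HeightOneSpectrum.valuation_of_algebraMap,
    HeightOneSpectrum.intValuation_eq_one_iff]
  change z ∉ Ideal.span {p} ↔ _
  rw [Ideal.mem_span_singleton]

/-- **`K1(S, 2)` (Silverman AEC X.1, the group `K(S, 2)`, for `K = ℚ(√-1)`,
`S = {primes dividing 2·3·5·41·73}`)**: a non-zero `x ∈ K1` whose `𝔭`-adic valuation is even at
every prime `p ∤ D` is `x = toK1 (i^a ∏_j (gen j)^(e j)) · t²` with `a, e j ∈ {0, 1}`,
`t ∈ K1ˣ`. [cite: SilvermanAEC2009, Ch. X §1 (K(S,2))] -/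
theorem K1.exists_sq_decomposition {x : K1} (hx : x ≠ 0)
    (h : ∀ (p : ℤ[i]) (hp : Prime p), ¬ p ∣ D →
      (2 : ℤ) ∣ WithZero.log ((primeSpec p hp).valuation K1 x)) :
    ∃ (a : ℕ) (e : Fin 8 → ℕ) (t : K1), t ≠ 0 ∧ a < 2 ∧ (∀ j, e j < 2) ∧
      x = toK1 (gI ^ a * genProd e) * t ^ 2 := by
  obtain ⟨z, N, hN, hxz⟩ := K1.exists_eq_toK1_div_nat x
  have hN0 : (N : ℤ[i]) ≠ 0 := by exact_mod_cast hN.ne'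
  have hNK : (N : K1) ≠ 0 := by exact_mod_cast hN.ne'
  have hz : z ≠ 0 := by
    rintro rfl
    rw [map_zero, zero_div] at hxz
    exact hx hxz
  -- `x = toK1 (z N) / N²`
  set Z : ℤ[i] := z * N with hZdef
  have hZ : Z ≠ 0 := mul_ne_zero hz hN0
  have hxZ : x = toK1 Z * ((N : K1)⁻¹) ^ 2 := by
    rw [hxz, hZdef, map_mul, toK1_natCast]
    field_simp
  have hZeven : ∀ p : ℤ[i], Prime p → ¬ p ∣ D → Even (multiplicity p Z) := by
    intro p hp hpD
    have h2 := h p hp hpD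
    rw [hxz, ← toK1_natCast, log_valuation_toK1_div hp hz hN0] at h2
    rw [hZdef, multiplicity_mul_eq hp hz hN0, Nat.even_iff]
    omega
  obtain ⟨a, e, t, ht, ha, he, hZe⟩ := exists_sq_decomposition_int hZ hZeven
  refine ⟨a, e, toK1 t * (N : K1)⁻¹, mul_ne_zero (toK1_ne_zero ht) (inv_ne_zero hNK), ha, he,
    ?_⟩
  rw [hxZ, hZe, map_mul, map_pow]
  ring

/-! ### Square-class characters -/

/-- **A `ℤ/2`-valued "character" on `ℤ[i] ∖ {0}`**: a function turning products of non-zero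
Gaussian integers into sums (e.g. the parity of the multiplicity at a prime, or a quadratic
character of a unit part). [folklore] -/
structure MulBit where
  /-- the underlying function (junk at `0`) -/
  toFun : ℤ[i] → ZMod 2
  /-- multiplicativity on non-zero elements -/
  map_mul' : ∀ {z w : ℤ[i]}, z ≠ 0 → w ≠ 0 → toFun (z * w) = toFun z + toFun w

namespace MulBit

variable (χ : MulBit)

/-- A `MulBit` is used as a function `ℤ[i] → ℤ/2`. [folklore] -/
instance : CoeFun MulBit (fun _ => ℤ[i] → ZMod 2) := ⟨MulBit.toFun⟩

/-- Multiplicativity. [folklore] -/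
theorem map_mul {z w : ℤ[i]} (hz : z ≠ 0) (hw : w ≠ 0) : χ (z * w) = χ z + χ w :=
  χ.map_mul' hz hw

/-- `χ 1 = 0`. [folklore] -/
theorem map_one : χ 1 = 0 := by
  have h := χ.map_mul one_ne_zero one_ne_zero
  rw [mul_one] at h
  have h2 := CharTwo.add_self_eq_zero (χ 1)
  rw [← h] at h2
  exact h2

/-- `χ (z²) = 0`. [folklore] -/
theorem map_sq {z : ℤ[i]} (hz : z ≠ 0) : χ (z ^ 2) = 0 := by
  rw [pow_two, χ.map_mul hz hz, CharTwo.add_self_eq_zero]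

/-- `χ (z^n) = n • χ z`. [folklore] -/
theorem map_pow {z : ℤ[i]} (hz : z ≠ 0) (n : ℕ) : χ (z ^ n) = n * χ z := by
  induction n with
  | zero => rw [pow_zero, χ.map_one, Nat.cast_zero, zero_mul]
  | succ n ih => rw [pow_succ, χ.map_mul (pow_ne_zero n hz) hz, ih]; push_cast; ring

/-- `χ` on a unit multiple `i^a`-power decomposition:
`χ (i^a ∏ (gen j)^(e j)) = a χ(i) + Σ_j (e j) χ(gen j)`. [folklore] -/
theorem map_gI_pow_mul_genProd (a : ℕ) (e : Fin 8 → ℕ) :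
    χ (gI ^ a * genProd e) = a * χ gI + ∑ j, (e j : ZMod 2) * χ (gen j) := by
  have hgI : gI ≠ 0 := by decide
  rw [χ.map_mul (pow_ne_zero a hgI) (genProd_ne_zero e), χ.map_pow hgI]
  congr 1
  unfold genProd
  -- induction over the finite product
  have key : ∀ s : Finset (Fin 8), χ (∏ j ∈ s, gen j ^ e j) = ∑ j ∈ s, (e j : ZMod 2) * χ (gen j) := by
    intro s
    induction s using Finset.induction_on with
    | empty => rw [Finset.prod_empty, Finset.sum_empty, χ.map_one]
    | insert j s hj ih =>
      rw [Finset.prod_insert hj, Finset.sum_insert hj,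
        χ.map_mul (pow_ne_zero _ (gen_ne_zero j))
          (Finset.prod_ne_zero_iff.mpr fun k _ => pow_ne_zero _ (gen_ne_zero k)),
        χ.map_pow (gen_ne_zero j), ih]
  exact key Finset.univ

/-- The chosen numerator of `x ∈ K1`: `x = toK1 (num x) / den x`. [folklore] -/
noncomputable def num (x : K1) : ℤ[i] := Classical.choose (K1.exists_eq_toK1_div_nat x)

/-- The chosen (positive natural) denominator of `x ∈ K1`. [folklore] -/
noncomputable def den (x : K1) : ℕ :=
  Classical.choose (Classical.choose_spec (K1.exists_eq_toK1_div_nat x))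

/-- `0 < den x`. [folklore] -/
theorem den_pos (x : K1) : 0 < den x :=
  (Classical.choose_spec (Classical.choose_spec (K1.exists_eq_toK1_div_nat x))).1

/-- `x = toK1 (num x) / den x`. [folklore] -/
theorem eq_num_div_den (x : K1) : x = toK1 (num x) / (den x : K1) :=
  (Classical.choose_spec (Classical.choose_spec (K1.exists_eq_toK1_div_nat x))).2

/-- `num x ≠ 0` for `x ≠ 0`. [folklore] -/
theorem num_ne_zero {x : K1} (hx : x ≠ 0) : num x ≠ 0 := by
  intro h
  have := eq_num_div_den x
  rw [h, _root_.map_zero, zero_div] at this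
  exact hx this

/-- **Extension of `χ` to `K1`**: `χ(toK1 z / N) = χ z + χ N` (junk at `0`). [folklore] -/
noncomputable def onK1 (x : K1) : ZMod 2 := χ (num x) + χ (den x : ℤ[i])

/-- **`onK1` does not depend on the fraction**: `χ.onK1 (toK1 z / toK1 w) = χ z + χ w` for all
non-zero `z, w`. [folklore] -/
theorem onK1_div {z w : ℤ[i]} (hz : z ≠ 0) (hw : w ≠ 0) :
    χ.onK1 (toK1 z / toK1 w) = χ z + χ w := by
  set x := toK1 z / toK1 w with hx
  have hden : ((den x : ℕ) : ℤ[i]) ≠ 0 := by exact_mod_cast (den_pos x).ne'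
  have hx0 : x ≠ 0 := div_ne_zero (toK1_ne_zero hz) (toK1_ne_zero hw)
  have hnum : num x ≠ 0 := num_ne_zero hx0
  -- cross-multiply: `num x * w = z * den x`
  have hcross : num x * w = z * (den x : ℤ[i]) := by
    apply toK1_injective
    rw [_root_.map_mul, _root_.map_mul, toK1_natCast]
    have h1 := eq_num_div_den x
    rw [hx] at h1
    have hwK : toK1 w ≠ 0 := toK1_ne_zero hw
    have hdK : ((den (toK1 z / toK1 w) : ℕ) : K1) ≠ 0 := by exact_mod_cast (den_pos _).ne'
    field_simp at h1
    linear_combination -h1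
  have key : χ (num x) + χ w = χ z + χ (den x : ℤ[i]) := by
    rw [← χ.map_mul hnum hw, ← χ.map_mul hz hden, hcross]
  unfold onK1
  -- in `ℤ/2`: from `χ num + χ w = χ z + χ den` deduce `χ num + χ den = χ z + χ w`
  have h2 := CharTwo.add_self_eq_zero (χ w)
  have h3 := CharTwo.add_self_eq_zero (χ (den x : ℤ[i]))
  linear_combination key + h3 - h2

/-- `onK1` on `toK1 z`. [folklore] -/
theorem onK1_toK1 {z : ℤ[i]} (hz : z ≠ 0) : χ.onK1 (toK1 z) = χ z := by
  have := χ.onK1_div hz one_ne_zero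
  rwa [_root_.map_one, div_one, χ.map_one, add_zero] at this

/-- **`onK1` is multiplicative on `K1ˣ`.** [folklore] -/
theorem onK1_mul {x y : K1} (hx : x ≠ 0) (hy : y ≠ 0) :
    χ.onK1 (x * y) = χ.onK1 x + χ.onK1 y := by
  obtain ⟨z, N, hN, rfl⟩ := K1.exists_eq_toK1_div_nat x
  obtain ⟨w, M, hM, rfl⟩ := K1.exists_eq_toK1_div_nat y
  have hN0 : (N : ℤ[i]) ≠ 0 := by exact_mod_cast hN.ne'
  have hM0 : (M : ℤ[i]) ≠ 0 := by exact_mod_cast hM.ne'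
  have hz : z ≠ 0 := by rintro rfl; exact hx (by rw [_root_.map_zero, zero_div])
  have hw : w ≠ 0 := by rintro rfl; exact hy (by rw [_root_.map_zero, zero_div])
  rw [← toK1_natCast, ← toK1_natCast] at *
  rw [div_mul_div_comm, ← _root_.map_mul, ← _root_.map_mul, χ.onK1_div hz hN0,
    χ.onK1_div hw hM0, χ.onK1_div (mul_ne_zero hz hw) (mul_ne_zero hN0 hM0), χ.map_mul hz hw,
    χ.map_mul hN0 hM0]
  ring

/-- `onK1` kills squares. [folklore] -/
theorem onK1_sq {t : K1} (ht : t ≠ 0) : χ.onK1 (t ^ 2) = 0 := by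
  rw [pow_two, χ.onK1_mul ht ht, CharTwo.add_self_eq_zero]

/-- **The value of `onK1` on a `K1(S,2)`-decomposition** `x = toK1 (i^a ∏ (gen j)^(e j)) · t²`
is the linear form `a χ(i) + Σ_j e_j χ(gen j)`. [folklore] -/
theorem onK1_decomposition (a : ℕ) (e : Fin 8 → ℕ) {t : K1} (ht : t ≠ 0) :
    χ.onK1 (toK1 (gI ^ a * genProd e) * t ^ 2) = a * χ gI + ∑ j, (e j : ZMod 2) * χ (gen j) := by
  have hG : gI ^ a * genProd e ≠ 0 := mul_ne_zero (pow_ne_zero a (by decide)) (genProd_ne_zero e)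
  rw [χ.onK1_mul (toK1_ne_zero hG) (pow_ne_zero 2 ht), χ.onK1_sq ht, add_zero, χ.onK1_toK1 hG,
    χ.map_gI_pow_mul_genProd]

/-- `onK1` as a monoid homomorphism `K1ˣ → ℤ/2`. [folklore] -/
noncomputable def unitsHom : K1ˣ →* Multiplicative (ZMod 2) where
  toFun u := Multiplicative.ofAdd (χ.onK1 (u : K1))
  map_one' := by
    rw [Units.val_one, ← _root_.map_one toK1, χ.onK1_toK1 one_ne_zero, χ.map_one]; rfl
  map_mul' u v := by
    rw [Units.val_mul, χ.onK1_mul u.ne_zero v.ne_zero, ofAdd_add]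

/-- Squares lie in the kernel of `unitsHom`. [folklore] -/
theorem range_powMonoidHom_le_ker_unitsHom :
    (powMonoidHom 2 : K1ˣ →* K1ˣ).range ≤ χ.unitsHom.ker := by
  rintro _ ⟨u, rfl⟩
  rw [MonoidHom.mem_ker]
  show Multiplicative.ofAdd (χ.onK1 ((u ^ 2 : K1ˣ) : K1)) = 1
  rw [Units.val_pow_eq_pow_val, χ.onK1_sq u.ne_zero]
  rfl

/-- **The square-class character `K1ˣ/K1ˣ² → ℤ/2` induced by `χ`** (on the tree's
`SqUnits K1`). [folklore] -/
noncomputable def hom : Additive (SqUnits K1) →+ ZMod 2 :=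
  MonoidHom.toAdditiveLeft
    (QuotientGroup.lift _ χ.unitsHom χ.range_powMonoidHom_le_ker_unitsHom)

/-- The value of `hom` on a square class. [folklore] -/
theorem hom_sqClass {x : K1} (hx : x ≠ 0) :
    χ.hom (Additive.ofMul (sqClass x)) = χ.onK1 x := by
  rw [sqClass_of_ne_zero hx, hom, MonoidHom.toAdditiveLeft]
  simp [unitsHom]

/-! ### First instance: the parity of the multiplicity at a prime -/

/-- **The parity of the multiplicity at a prime `p`** as a `MulBit`. [folklore] -/
noncomputable def ofPrime (p : ℤ[i]) (hp : Prime p) : MulBit where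
  toFun z := (multiplicity p z : ZMod 2)
  map_mul' hz hw := by rw [multiplicity_mul_eq hp hz hw, Nat.cast_add]

/-- Value of `ofPrime`. [folklore] -/
theorem ofPrime_apply {p : ℤ[i]} (hp : Prime p) (z : ℤ[i]) :
    ofPrime p hp z = (multiplicity p z : ZMod 2) := rfl

/-- `ofPrime p` vanishes on elements not divisible by `p`. [folklore] -/
theorem ofPrime_of_not_dvd {p : ℤ[i]} (hp : Prime p) {z : ℤ[i]} (h : ¬ p ∣ z) :
    ofPrime p hp z = 0 := by
  rw [ofPrime_apply, multiplicity_eq_zero_of_not_dvd h, Nat.cast_zero]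

/-- `ofPrime p (p^m c) = m` for `p ∤ c`. [folklore] -/
theorem ofPrime_pow_mul {p : ℤ[i]} (hp : Prime p) {c : ℤ[i]} (hc : ¬ p ∣ c) (m : ℕ) :
    ofPrime p hp (p ^ m * c) = m := by
  rw [ofPrime_apply, multiplicity_pow_mul_of_not_dvd hp hc]

/-- **`ofPrime` on `K1` is the parity of the `𝔭`-adic valuation**: for `x ≠ 0`,
`(ofPrime p).onK1 x = 0 ↔ 2 ∣ log v_𝔭(x)`. [folklore] -/
theorem ofPrime_onK1_eq_zero_iff {p : ℤ[i]} (hp : Prime p) {x : K1} (hx : x ≠ 0) :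
    (ofPrime p hp).onK1 x = 0 ↔ (2 : ℤ) ∣ WithZero.log ((primeSpec p hp).valuation K1 x) := by
  obtain ⟨z, N, hN, rfl⟩ := K1.exists_eq_toK1_div_nat x
  have hN0 : (N : ℤ[i]) ≠ 0 := by exact_mod_cast hN.ne'
  have hz : z ≠ 0 := by rintro rfl; exact hx (by rw [_root_.map_zero, zero_div])
  rw [← toK1_natCast, (ofPrime p hp).onK1_div hz hN0, log_valuation_toK1_div hp hz hN0,
    ofPrime_apply, ofPrime_apply, ← Nat.cast_add, ZMod.natCast_eq_zero_iff_even, Nat.even_iff]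
  omega

end MulBit

end Literature.Barriers.BirchSwinnertonDyer.DokchitserDokchitser2011
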